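import Literature.NumberTheory.QuadraticFields.ClassNumberOne
import Literature.NumberTheory.EllipticCurves.QuadraticOrderPlace
import Mathlib.Algebra.QuadraticAlgebra.Basic
import Mathlib.RingTheory.Trace.Basic
import Mathlib.Tactic.NormNum.Prime
import Mathlib.RingTheory.Prime
import HarnessLib

/-!
# The ring of integers of `ℚ(√d)`, `d ≡ 1 (mod 4)` squarefree, is `ℤ[½(1 + √d)]` — as a ring isomorphism with Mathlib's
# `QuadraticAlgebra ℤ a 1` (`ω² = a + ω`, `d = 4a + 1`); hence `ℤ[½(1+√d)]` is a PID for `d = −3, −7, −11, −19, −43, −67, −163`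

Topic `Literature/NumberTheory/QuadraticFields`, namespace `Literature.NumberTheory.QuadraticFields.OmegaIntegers`.
Marcus, *Number Fields*, Ch. 2, Thm. 1 with Cor. 2 («Let `m` be a squarefree integer … if `m ≡ 1 (mod 4)` the set of algebraic integers
in `ℚ[√m]` is `{(a + b√m)/2 : a ≡ b (mod 2)} = ℤ[(1 + √m)/2]`»), for a GIVEN quadratic number field `K` (`[K : ℚ] = 2`) presented by a
square root `θ ∈ K ∖ ℚ`, `θ² = d = 4a + 1` squarefree.  Neither Mathlib nor the tree had the ring of integers of a quadratic field
(`ClassNumberOne.lean` deliberately avoided computing it); the tree's arithmetic of the orders `ℤ[½(1+√d)]` is written on the concrete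
model `QuadraticAlgebra ℤ a 1` (`OmegaNegSevenHeckeSums`, `EuclideanQuadraticFieldFundamentalTheorem`), which so far met `𝓞 K` only for
the EUCLIDEAN `d = −3, −7, −11`.  This file identifies the two, so that class-number-one theorems about `𝓞 K`
(`Quadratic.isPrincipalIdealRing_of_sq_eq_intCast`: the nine imaginary quadratic fields) transfer to the model — in particular to the
NON-Euclidean `ℤ[½(1+√−19)]`, `ℤ[½(1+√−43)]`, `ℤ[½(1+√−67)]`, `ℤ[½(1+√−163)]`.

* `omega θ = ½(1 + θ)`, `omega_mul_omega : ω·ω = a + ω`; `toField a θ hsq : QuadraticAlgebra ℤ a 1 →ₐ[ℤ] K`, `x + yω ↦ x + y·½(1+θ)`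
  (Mathlib's `QuadraticAlgebra.lift`), `toField_injective`, `isIntegral_toField`;
* ★ `exists_toField_eq_of_isIntegral` — **every algebraic integer of `K` is `x + yω` with `x, y ∈ ℤ`**.  Proof by TRACES only: for
  `z = r + sθ` integral, `Tr z = 2r`, `Tr zθ = 2sd`, `Tr z² = 2(r² + s²d)` are rational integers (`Algebra.isIntegral_trace`, `ℤ` integrally
  closed), and `2dl = dm² + k²` with `d` squarefree odd forces `k = dn`, `s = n/2`, `r = m/2`, `m ≡ n (mod 2)` (`exists_coords_of_traces`);
* `toIntegers`, ★★ `equivIntegers : QuadraticAlgebra ℤ a 1 ≃+* 𝓞 K`, `isDomain_of_sq_eq`, `isPrincipalIdealRing_of_sq_eq` (transport);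
* ★★ `isPrincipalIdealRing_of_mem` — **`ℤ[½(1+√d)] = QuadraticAlgebra ℤ ((d−1)/4) 1` is a principal ideal ring for
  `d ∈ {−3, −7, −11, −19, −43, −67, −163}`** (with `K = sqrtField d`), and `uniqueFactorizationMonoid_of_mem`.

## References
* D. A. Marcus, *Number Fields*, 2nd ed. (2018), Ch. 2, Thm. 1 and Cor. 2; Ch. 5, Thm. 37 Cor. 2 and Exercise 9. [Marcus2018]
* G. H. Hardy, E. M. Wright, *An Introduction to the Theory of Numbers*, 6th ed., §14.2–14.3, Thm. 238. [HardyWright2008]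

## Mathlib / tree search
Mathlib: `QuadraticAlgebra.lift`, `Algebra.isIntegral_trace`, `IsIntegrallyClosed.isIntegral_iff`, `Algebra.trace_eq_matrix_trace`,
`IsPrincipalIdealRing.of_surjective`, `MulEquiv.isDomain`, `RingEquiv.ofBijective` (no `RingOfIntegers` of a quadratic field: searched
`NumberTheory/NumberField`, `NumberTheory/Zsqrtd`).  Tree: `Quadratic.basisOneSqrt`, `Quadratic.exists_eq_add_mul`, `Quadratic.ext_add_mul`
(`SquareRootGenerator`), `Quadratic.isPrincipalIdealRing_of_sq_eq_intCast` (`ClassNumberOne`), `sqrtField` (`QuadraticOrderPlace`).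
-/

noncomputable section

open Module NumberField Polynomial

namespace Literature.NumberTheory.QuadraticFields.OmegaIntegers

open Literature.NumberTheory.QuadraticFields.Quadratic

variable {K : Type*} [Field K] [NumberField K]

/-! ## §1 `ω = ½(1 + θ)` and the map `ℤ[ω] → K` -/

/-- `ω = ½(1 + θ)` for a square root `θ` of `d = 4a + 1`. [cite: Marcus2018, Ch. 2 Cor. 2 of Thm. 1] -/
def omega (θ : K) : K := (1 + θ) / 2

variable {θ : K} {a : ℤ}

/-- `ω² = a + ω` (as `θ² = 4a + 1`), in the shape required by `QuadraticAlgebra.lift` (`ω·ω = a•1 + 1•ω`). [cite: Marcus2018, Ch. 2 Cor. 2 of Thm. 1] -/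
theorem omega_mul_omega (hsq : θ ^ 2 = ((4 * a + 1 : ℤ) : K)) : omega θ * omega θ = a • (1 : K) + (1 : ℤ) • omega θ := by
  rw [zsmul_eq_mul, one_zsmul, mul_one, omega]
  push_cast at hsq
  linear_combination hsq / 4

/-- **The ring map `ℤ[ω] → K`, `x + yω ↦ x + y·½(1+θ)`** (`ℤ[ω] = QuadraticAlgebra ℤ a 1`, `ω² = a + ω`; Mathlib's universal property
`QuadraticAlgebra.lift`). [cite: Marcus2018, Ch. 2 Cor. 2 of Thm. 1] -/
def toField (a : ℤ) (θ : K) (hsq : θ ^ 2 = ((4 * a + 1 : ℤ) : K)) : QuadraticAlgebra ℤ a 1 →ₐ[ℤ] K :=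
  QuadraticAlgebra.lift ⟨omega θ, omega_mul_omega hsq⟩

/-- `toField (x + yω) = x + y·ω`. [cite: Marcus2018, Ch. 2 Cor. 2 of Thm. 1] -/
theorem toField_apply (hsq : θ ^ 2 = ((4 * a + 1 : ℤ) : K)) (z : QuadraticAlgebra ℤ a 1) :
    toField a θ hsq z = (z.re : K) + (z.im : K) * omega θ := by
  rw [toField, QuadraticAlgebra.lift_apply_apply, zsmul_eq_mul, zsmul_eq_mul, mul_one]

/-- `toField ⟨x, y⟩ = x + y·ω`. [cite: Marcus2018, Ch. 2 Cor. 2 of Thm. 1] -/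
theorem toField_mk (hsq : θ ^ 2 = ((4 * a + 1 : ℤ) : K)) (x y : ℤ) :
    toField a θ hsq ⟨x, y⟩ = (x : K) + (y : K) * omega θ :=
  toField_apply hsq _

/-- In the coordinates `1, θ`: `toField (x + yω) = (x + y/2) + (y/2)·θ`. [cite: Marcus2018, Ch. 2 Cor. 2 of Thm. 1] -/
theorem toField_apply_eq_ratCast (hsq : θ ^ 2 = ((4 * a + 1 : ℤ) : K)) (z : QuadraticAlgebra ℤ a 1) :
    toField a θ hsq z = ((z.re + z.im / 2 : ℚ) : K) + ((z.im / 2 : ℚ) : K) * θ := by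
  rw [toField_apply hsq, omega]
  push_cast
  ring

/-- `θ = toField (−1 + 2ω)`. [cite: Marcus2018, Ch. 2 Cor. 2 of Thm. 1] -/
theorem toField_theta (hsq : θ ^ 2 = ((4 * a + 1 : ℤ) : K)) : toField a θ hsq ⟨-1, 2⟩ = θ := by
  rw [toField_mk hsq, omega]; push_cast; ring

/-- Every `x + yω` is an algebraic integer (`ℤ[ω]` is a finite `ℤ`-algebra). [cite: Marcus2018, Ch. 2 Cor. 2 of Thm. 1] -/
theorem isIntegral_toField (hsq : θ ^ 2 = ((4 * a + 1 : ℤ) : K)) (z : QuadraticAlgebra ℤ a 1) : IsIntegral ℤ (toField a θ hsq z) :=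
  (Algebra.IsIntegral.isIntegral (R := ℤ) z).map (toField a θ hsq)

/-- `θ` is an algebraic integer. [cite: Marcus2018, Ch. 2 Cor. 2 of Thm. 1] -/
theorem isIntegral_theta (hsq : θ ^ 2 = ((4 * a + 1 : ℤ) : K)) : IsIntegral ℤ θ := by
  rw [← toField_theta hsq]; exact isIntegral_toField hsq _

/-- **`toField` is injective** (for `θ ∉ ℚ`: `1, θ` are `ℚ`-linearly independent). [cite: Marcus2018, Ch. 2 Cor. 2 of Thm. 1] -/
theorem toField_injective (hθ : θ ∉ Set.range (algebraMap ℚ K)) (hsq : θ ^ 2 = ((4 * a + 1 : ℤ) : K)) :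
    Function.Injective (toField a θ hsq) := by
  rw [injective_iff_map_eq_zero]
  intro z hz
  rw [toField_apply_eq_ratCast hsq, ← eq_ratCast (algebraMap ℚ K), ← eq_ratCast (algebraMap ℚ K)] at hz
  have h0 : algebraMap ℚ K (z.re + z.im / 2 : ℚ) + algebraMap ℚ K (z.im / 2 : ℚ) * θ = algebraMap ℚ K 0 + algebraMap ℚ K 0 * θ := by
    rw [hz, map_zero, zero_mul, add_zero]
  obtain ⟨h1, h2⟩ := ext_add_mul hθ h0
  have him : z.im = 0 := by
    have : (z.im : ℚ) = 0 := by linarith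
    exact_mod_cast this
  have hre : z.re = 0 := by
    have : (z.re : ℚ) = 0 := by rw [him] at h1; simpa using h1
    exact_mod_cast this
  ext <;> simp [him, hre]

/-! ## §2 Traces: every algebraic integer of `K` lies in `ℤ[ω]` -/

/-- `Tr_{K/ℚ}(r + sθ) = 2r` (`Tr 1 = 2`, `Tr θ = 0`). [cite: Marcus2018, Ch. 2 Thm. 1 (proof)] -/
theorem trace_ratCast_add_ratCast_mul (h2 : finrank ℚ K = 2) (hθ : θ ∉ Set.range (algebraMap ℚ K)) {d : ℤ}
    (hsq : θ ^ 2 = (d : K)) (r s : ℚ) : Algebra.trace ℚ K ((r : K) + (s : K) * θ) = 2 * r := by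
  set b := basisOneSqrt h2 hθ with hb
  have hθθ : θ * θ = algebraMap ℚ K (d : ℚ) := by rw [← sq, hsq, map_intCast]
  have hb0 : b 0 = 1 := by simp [hb]
  have hb1 : b 1 = θ := by simp [hb]
  have trθ : Algebra.trace ℚ K θ = 0 := by
    rw [Algebra.trace_eq_matrix_trace b, Matrix.trace_fin_two, Algebra.leftMulMatrix_eq_repr_mul,
      Algebra.leftMulMatrix_eq_repr_mul, hb0, hb1, mul_one, hθθ, Algebra.algebraMap_eq_smul_one,
      ← hb0, ← hb1, b.repr_self, LinearEquiv.map_smul, b.repr_self]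
    simp
  have e1 : (r : K) = algebraMap ℚ K r := (eq_ratCast _ _).symm
  have e2 : (s : K) * θ = s • θ := by rw [Algebra.smul_def, eq_ratCast]
  rw [map_add, e1, Algebra.trace_algebraMap, h2, e2, LinearMap.map_smul, trθ, smul_zero, add_zero, nsmul_eq_mul, Nat.cast_ofNat]

/-- **The arithmetic core** («`a ≡ b (mod 2)`»): if `2r = m`, `2sd = k`, `2(r² + s²d) = l` are integers with `d` squarefree and odd, then
`r = x + y/2`, `s = y/2` for integers `x, y` — from `2dl = dm² + k²`: `d ∣ k²` so `d ∣ k = dn`, then `2l = m² + dn²` so `m ≡ n (mod 2)`.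
[cite: Marcus2018, Ch. 2 Thm. 1 (proof)] -/
theorem exists_coords_of_traces {d : ℤ} (hd2 : ¬ 2 ∣ d) (hsf : Squarefree d) {r s : ℚ} {m k l : ℤ}
    (hm : (m : ℚ) = 2 * r) (hk : (k : ℚ) = 2 * s * d) (hl : (l : ℚ) = 2 * (r ^ 2 + s ^ 2 * d)) :
    ∃ x y : ℤ, r = x + y / 2 ∧ s = y / 2 := by
  have hd0 : d ≠ 0 := fun h ↦ hd2 (h ▸ dvd_zero 2)
  have h1 : 2 * d * l = d * m ^ 2 + k ^ 2 := by
    have : (2 * d * l : ℚ) = d * m ^ 2 + k ^ 2 := by rw [hl, hm, hk]; ring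
    exact_mod_cast this
  have hdk : d ∣ k ^ 2 := ⟨2 * l - m ^ 2, by linear_combination -h1⟩
  obtain ⟨n, hn⟩ := (hsf.dvd_pow_iff_dvd two_ne_zero).mp hdk
  have h2 : 2 * l = m ^ 2 + d * n ^ 2 := by
    refine mul_left_cancel₀ hd0 ?_
    rw [hn] at h1
    linear_combination h1
  have hpar : Even (m - n) := by
    have he : Even (m ^ 2 + d * n ^ 2) := ⟨l, by linear_combination -h2⟩
    have hnd : ¬ Even d := fun h ↦ hd2 (even_iff_two_dvd.mp h)
    rw [Int.even_add, Int.even_mul, Int.even_pow, Int.even_pow] at he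
    rw [Int.even_sub]
    simpa [hnd] using he
  obtain ⟨x, hx⟩ := hpar
  have hdQ : (d : ℚ) ≠ 0 := by exact_mod_cast hd0
  have hs : s = n / 2 := by
    have h3 : (2 * s) * (d : ℚ) = (n : ℚ) * d := by
      have : (k : ℚ) = (d : ℚ) * n := by rw [hn]; push_cast; ring
      linear_combination hk.symm.trans this
    have h4 := mul_right_cancel₀ hdQ h3
    linarith
  refine ⟨x, n, ?_, hs⟩
  have hxQ : (m : ℚ) - n = x + x := by exact_mod_cast hx
  linarith

/-- ★ **Every algebraic integer of `K = ℚ(√d)`, `d = 4a + 1` squarefree, is `x + yω` with `x, y ∈ ℤ`** (`ω = ½(1+√d)`): the inclusion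
`𝓞 K ⊆ ℤ[ω]` of Marcus's Cor. 2, proved by traces. [cite: Marcus2018, Ch. 2 Thm. 1 and Cor. 2] -/
theorem exists_toField_eq_of_isIntegral (h2 : finrank ℚ K = 2) (hθ : θ ∉ Set.range (algebraMap ℚ K))
    (hsq : θ ^ 2 = ((4 * a + 1 : ℤ) : K)) (hsf : Squarefree (4 * a + 1)) {z : K} (hz : IsIntegral ℤ z) :
    ∃ w : QuadraticAlgebra ℤ a 1, toField a θ hsq w = z := by
  set d : ℤ := 4 * a + 1 with hd
  have hd2 : ¬ 2 ∣ d := by omega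
  have hθint : IsIntegral ℤ θ := isIntegral_theta hsq
  have hθθ : θ * θ = (d : K) := by rw [← sq, hsq]
  -- coordinates of `z`
  obtain ⟨r, s, hz'⟩ := exists_eq_add_mul h2 hθ z
  rw [eq_ratCast, eq_ratCast] at hz'
  -- the three traces (the trace of an algebraic integer is a rational integer: the tree's `CyclicCubic103.exists_int_eq_trace`, inlined)
  have exists_intCast_eq_trace : ∀ {w : K}, IsIntegral ℤ w → ∃ m : ℤ, (m : ℚ) = Algebra.trace ℚ K w :=
    fun hw ↦ IsIntegrallyClosed.isIntegral_iff.mp (Algebra.isIntegral_trace hw)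
  have tr := trace_ratCast_add_ratCast_mul h2 hθ hsq
  obtain ⟨m, hm⟩ := exists_intCast_eq_trace hz
  rw [hz', tr] at hm
  obtain ⟨k, hk⟩ := exists_intCast_eq_trace (hz.mul hθint)
  have hzθ : z * θ = ((s * d : ℚ) : K) + (r : K) * θ := by
    rw [hz']; push_cast; linear_combination (s : K) * hθθ
  rw [hzθ, tr] at hk
  obtain ⟨l, hl⟩ := exists_intCast_eq_trace (hz.mul hz)
  have hzz : z * z = ((r ^ 2 + s ^ 2 * d : ℚ) : K) + ((2 * r * s : ℚ) : K) * θ := by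
    rw [hz']; push_cast; linear_combination (s : K) ^ 2 * hθθ
  rw [hzz, tr] at hl
  obtain ⟨x, y, hr, hs⟩ := exists_coords_of_traces hd2 hsf hm (by rw [hk]; ring) hl
  refine ⟨⟨x, y⟩, ?_⟩
  rw [toField_mk hsq, omega, hz', hr, hs]
  push_cast
  ring

/-! ## §3 The isomorphism `ℤ[ω] ≅ 𝓞 K` and the transfer of `IsDomain` / PID -/

/-- The ring map `ℤ[ω] → 𝓞 K` (`toField` with its integrality certificate). [cite: Marcus2018, Ch. 2 Cor. 2 of Thm. 1] -/
def toIntegers (a : ℤ) (θ : K) (hsq : θ ^ 2 = ((4 * a + 1 : ℤ) : K)) : QuadraticAlgebra ℤ a 1 →+* 𝓞 K where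
  toFun := RingOfIntegers.restrict (toField a θ hsq) (isIntegral_toField hsq)
  map_one' := by simp only [RingOfIntegers.restrict, map_one]; rfl
  map_mul' z w := by simp only [RingOfIntegers.restrict, map_mul]; rfl
  map_zero' := by simp only [RingOfIntegers.restrict, map_zero]; rfl
  map_add' z w := by simp only [RingOfIntegers.restrict, map_add]; rfl

/-- `toIntegers z`, as an element of `K`, is `toField z`. [cite: Marcus2018, Ch. 2 Cor. 2 of Thm. 1] -/
theorem coe_toIntegers (hsq : θ ^ 2 = ((4 * a + 1 : ℤ) : K)) (z : QuadraticAlgebra ℤ a 1) :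
    ((toIntegers a θ hsq z : 𝓞 K) : K) = toField a θ hsq z := rfl

/-- `toIntegers` is a bijection `ℤ[ω] → 𝓞 K`. [cite: Marcus2018, Ch. 2 Thm. 1 and Cor. 2] -/
theorem toIntegers_bijective (h2 : finrank ℚ K = 2) (hθ : θ ∉ Set.range (algebraMap ℚ K))
    (hsq : θ ^ 2 = ((4 * a + 1 : ℤ) : K)) (hsf : Squarefree (4 * a + 1)) : Function.Bijective (toIntegers a θ hsq) := by
  refine ⟨fun z w h ↦ toField_injective hθ hsq ?_, fun t ↦ ?_⟩
  · have := congrArg (fun u : 𝓞 K ↦ (u : K)) h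
    simpa only [coe_toIntegers] using this
  · obtain ⟨w, hw⟩ := exists_toField_eq_of_isIntegral h2 hθ hsq hsf (RingOfIntegers.isIntegral_coe t)
    exact ⟨w, RingOfIntegers.ext (by rw [coe_toIntegers, hw])⟩

/-- ★★ **`ℤ[½(1+√d)] ≅ 𝓞 ℚ(√d)`** for `d = 4a + 1` squarefree: the ring isomorphism `QuadraticAlgebra ℤ a 1 ≃+* 𝓞 K` for any quadratic
number field `K ∋ θ ∉ ℚ` with `θ² = d`. [cite: Marcus2018, Ch. 2 Thm. 1 and Cor. 2] -/
def equivIntegers (h2 : finrank ℚ K = 2) (hθ : θ ∉ Set.range (algebraMap ℚ K))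
    (hsq : θ ^ 2 = ((4 * a + 1 : ℤ) : K)) (hsf : Squarefree (4 * a + 1)) : QuadraticAlgebra ℤ a 1 ≃+* 𝓞 K :=
  RingEquiv.ofBijective (toIntegers a θ hsq) (toIntegers_bijective h2 hθ hsq hsf)

/-- `equivIntegers z`, as an element of `K`, is `toField z`. [cite: Marcus2018, Ch. 2 Cor. 2 of Thm. 1] -/
theorem coe_equivIntegers (h2 : finrank ℚ K = 2) (hθ : θ ∉ Set.range (algebraMap ℚ K))
    (hsq : θ ^ 2 = ((4 * a + 1 : ℤ) : K)) (hsf : Squarefree (4 * a + 1)) (z : QuadraticAlgebra ℤ a 1) :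
    ((equivIntegers h2 hθ hsq hsf z : 𝓞 K) : K) = toField a θ hsq z := rfl

/-- `ℤ[½(1+√d)]` is an integral domain (transported from `𝓞 K`). [cite: Marcus2018, Ch. 2 Cor. 2 of Thm. 1] -/
theorem isDomain_of_sq_eq (h2 : finrank ℚ K = 2) (hθ : θ ∉ Set.range (algebraMap ℚ K))
    (hsq : θ ^ 2 = ((4 * a + 1 : ℤ) : K)) (hsf : Squarefree (4 * a + 1)) : IsDomain (QuadraticAlgebra ℤ a 1) :=
  MulEquiv.isDomain (𝓞 K) (equivIntegers h2 hθ hsq hsf).toMulEquiv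

/-- **PID transfer**: if `𝓞 K` is a principal ideal ring then so is `ℤ[½(1+√d)] = QuadraticAlgebra ℤ a 1`.
[cite: Marcus2018, Ch. 5 Exercise 9] -/
theorem isPrincipalIdealRing_of_sq_eq (h2 : finrank ℚ K = 2) (hθ : θ ∉ Set.range (algebraMap ℚ K))
    (hsq : θ ^ 2 = ((4 * a + 1 : ℤ) : K)) (hsf : Squarefree (4 * a + 1)) (hP : IsPrincipalIdealRing (𝓞 K)) :
    IsPrincipalIdealRing (QuadraticAlgebra ℤ a 1) :=
  IsPrincipalIdealRing.of_surjective (equivIntegers h2 hθ hsq hsf).symm.toRingHom (equivIntegers h2 hθ hsq hsf).symm.surjective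

/-! ## §4 The seven class-number-one orders `ℤ[½(1+√d)]`, `d = −3, −7, −11, −19, −43, −67, −163` -/

/-- The seven discriminants are squarefree (each is `−q`, `q` prime). [folklore] -/
private theorem squarefree_of_mem {d : ℤ} (hd : d ∈ ({-3, -7, -11, -19, -43, -67, -163} : Finset ℤ)) : Squarefree d := by
  simp only [Finset.mem_insert, Finset.mem_singleton] at hd
  rcases hd with rfl | rfl | rfl | rfl | rfl | rfl | rfl
  · have h : Prime (3 : ℤ) := Int.prime_iff_natAbs_prime.mpr (by norm_num)
    exact (Prime.neg h).squarefree
  · have h : Prime (7 : ℤ) := Int.prime_iff_natAbs_prime.mpr (by norm_num)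
    exact (Prime.neg h).squarefree
  · have h : Prime (11 : ℤ) := Int.prime_iff_natAbs_prime.mpr (by norm_num)
    exact (Prime.neg h).squarefree
  · have h : Prime (19 : ℤ) := Int.prime_iff_natAbs_prime.mpr (by norm_num)
    exact (Prime.neg h).squarefree
  · have h : Prime (43 : ℤ) := Int.prime_iff_natAbs_prime.mpr (by norm_num)
    exact (Prime.neg h).squarefree
  · have h : Prime (67 : ℤ) := Int.prime_iff_natAbs_prime.mpr (by norm_num)
    exact (Prime.neg h).squarefree
  · have h : Prime (163 : ℤ) := Int.prime_iff_natAbs_prime.mpr (by norm_num)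
    exact (Prime.neg h).squarefree

/-- ★★ **`ℤ[½(1+√d)]` is a principal ideal ring for `d ∈ {−3, −7, −11, −19, −43, −67, −163}`**, i.e. `QuadraticAlgebra ℤ a 1` is a PID for
`a = (d − 1)/4 ∈ {−1, −2, −3, −5, −11, −17, −41}`: class number one of `K = ℚ(√d)` (`Quadratic.isPrincipalIdealRing_of_sq_eq_intCast`,
Minkowski) transported along `equivIntegers` (with the model `K = sqrtField d`).  For `d = −19, −43, −67, −163` these rings are NOT
Euclidean; the tree's `ufm_omega_neg_three/seven/eleven` covered the Euclidean ones. [cite: Marcus2018, Ch. 5 Exercise 9] -/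
theorem isPrincipalIdealRing_of_mem {a d : ℤ} (hda : d = 4 * a + 1)
    (hd : d ∈ ({-3, -7, -11, -19, -43, -67, -163} : Finset ℤ)) : IsPrincipalIdealRing (QuadraticAlgebra ℤ a 1) := by
  have hd0 : d < 0 := by simp only [Finset.mem_insert, Finset.mem_singleton] at hd; omega
  haveI : Fact (d < 0) := ⟨hd0⟩
  haveI : NumberField (Literature.NumberTheory.EllipticCurves.sqrtField d) := NumberField.mk
  have hsf : Squarefree (4 * a + 1) := hda ▸ squarefree_of_mem hd
  have hsq : Literature.NumberTheory.EllipticCurves.sqrtField.r d ^ 2 = ((4 * a + 1 : ℤ) : Literature.NumberTheory.EllipticCurves.sqrtField d) := by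
    rw [Literature.NumberTheory.EllipticCurves.sqrtField.r_sq']
    exact congrArg (fun t : ℤ ↦ (t : Literature.NumberTheory.EllipticCurves.sqrtField d)) hda
  have hmem : d ∈ ({-3, -4, -7, -8, -11, -19, -43, -67, -163} : Finset ℤ) := by
    simp only [Finset.mem_insert, Finset.mem_singleton] at hd ⊢; omega
  exact isPrincipalIdealRing_of_sq_eq (Literature.NumberTheory.EllipticCurves.sqrtField.finrank_eq_two d)
    (Literature.NumberTheory.EllipticCurves.sqrtField.r_not_mem_range d) hsq hsf
    (isPrincipalIdealRing_of_sq_eq_intCast (Literature.NumberTheory.EllipticCurves.sqrtField.finrank_eq_two d)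
      (Literature.NumberTheory.EllipticCurves.sqrtField.r_sq' d) hmem)

/-- `ℤ[½(1+√d)]` is an integral domain for these `d` (indeed for every squarefree `d = 4a + 1 < 0`). [cite: Marcus2018, Ch. 2 Cor. 2 of Thm. 1] -/
theorem isDomain_of_mem {a d : ℤ} (hda : d = 4 * a + 1)
    (hd : d ∈ ({-3, -7, -11, -19, -43, -67, -163} : Finset ℤ)) : IsDomain (QuadraticAlgebra ℤ a 1) := by
  have hd0 : d < 0 := by simp only [Finset.mem_insert, Finset.mem_singleton] at hd; omega
  haveI : Fact (d < 0) := ⟨hd0⟩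
  haveI : NumberField (Literature.NumberTheory.EllipticCurves.sqrtField d) := NumberField.mk
  have hsf : Squarefree (4 * a + 1) := hda ▸ squarefree_of_mem hd
  have hsq : Literature.NumberTheory.EllipticCurves.sqrtField.r d ^ 2 = ((4 * a + 1 : ℤ) : Literature.NumberTheory.EllipticCurves.sqrtField d) := by
    rw [Literature.NumberTheory.EllipticCurves.sqrtField.r_sq']
    exact congrArg (fun t : ℤ ↦ (t : Literature.NumberTheory.EllipticCurves.sqrtField d)) hda
  exact isDomain_of_sq_eq (Literature.NumberTheory.EllipticCurves.sqrtField.finrank_eq_two d)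
    (Literature.NumberTheory.EllipticCurves.sqrtField.r_not_mem_range d) hsq hsf

/-- ★★ **Unique factorisation in `ℤ[½(1+√d)]` for `d ∈ {−3, −7, −11, −19, −43, −67, −163}`** (PID ⇒ UFD), in the shape of the tree's
`ufm_omega_neg_*` theorems. [cite: Marcus2018, Ch. 5 Exercise 9] [cite: HardyWright2008, Thm 238] -/
theorem uniqueFactorizationMonoid_of_mem {a d : ℤ} (hda : d = 4 * a + 1)
    (hd : d ∈ ({-3, -7, -11, -19, -43, -67, -163} : Finset ℤ)) :
    ∃ _ : IsDomain (QuadraticAlgebra ℤ a 1), UniqueFactorizationMonoid (QuadraticAlgebra ℤ a 1) := by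
  haveI := isDomain_of_mem hda hd
  haveI := isPrincipalIdealRing_of_mem hda hd
  exact ⟨inferInstance, inferInstance⟩

/-- **`ℤ[½(1+√−19)]` is a principal ideal ring** (`ω² = ω − 5`; the standard example of a non-Euclidean PID). [cite: Marcus2018, Ch. 5 Exercise 9] -/
theorem isPrincipalIdealRing_omega_neg_nineteen : IsPrincipalIdealRing (QuadraticAlgebra ℤ (-5) 1) :=
  isPrincipalIdealRing_of_mem (d := -19) (by norm_num) (by decide)

/-- **`ℤ[½(1+√−43)]` is a principal ideal ring** (`ω² = ω − 11`). [cite: Marcus2018, Ch. 5 Exercise 9] -/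
theorem isPrincipalIdealRing_omega_neg_fortyThree : IsPrincipalIdealRing (QuadraticAlgebra ℤ (-11) 1) :=
  isPrincipalIdealRing_of_mem (d := -43) (by norm_num) (by decide)

/-- **`ℤ[½(1+√−67)]` is a principal ideal ring** (`ω² = ω − 17`). [cite: Marcus2018, Ch. 5 Exercise 9] -/
theorem isPrincipalIdealRing_omega_neg_sixtySeven : IsPrincipalIdealRing (QuadraticAlgebra ℤ (-17) 1) :=
  isPrincipalIdealRing_of_mem (d := -67) (by norm_num) (by decide)

/-- **`ℤ[½(1+√−163)]` is a principal ideal ring** (`ω² = ω − 41`). [cite: Marcus2018, Ch. 5 Exercise 9] -/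
theorem isPrincipalIdealRing_omega_neg_oneSixtyThree : IsPrincipalIdealRing (QuadraticAlgebra ℤ (-41) 1) :=
  isPrincipalIdealRing_of_mem (d := -163) (by norm_num) (by decide)

end Literature.NumberTheory.QuadraticFields.OmegaIntegers

end
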